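import Literature.AlgebraicGeometry.Resolution.WeightedCentreZKernelFlow
import HarnessLib

/-!
# Weighted centres — THEOREM A⁺: the `k[T]`-data are bottom-triangular

Instrument for engine 1's `W(f)` TOY MODEL (cell `pub-rosobs`, LF-MODEL-eng1-g45 §6.2 THEOREM A⁺), NOT a resolution theorem and NOT about the invariant of
[AbramovichTemkinWlodarczyk2024].

The `k[T]`-substitution `ψ = aeval P` of THEOREM A⁺ has slot data `P_i = exp_{<p}(T𝔇)(ε_i) + a_i T^q` (`q ≥ 1`, `𝔇` of degree `−r < 0`, `a_i` of weight `w i − (p+1)`;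
`WeightedCentreBottomExpand.exists_expand_slots`, `WeightedCentreBottomExpand.sigmaExp_eq_C_of_three_le` with `a = 0`) or `P_i = ε_i` (heavy slots).  This file checks the two
WEIGHT hypotheses of the kill coordinates (`WeightedCentreBottomKill.killRank_lt_of_bottom`): `P_i ≡ ε_i (mod T)` (`coeff_zero_slotData`) and "higher `T`-coefficients only
involve variables lighter than `ε_i`" (`lt_of_mem_vars_coeff_slotData`).  Pure bookkeeping on `coeff_sigmaExp_X`, `TailedLightFlow.isWeightedHomogeneous_iterate_X`, `ZKernel.le_of_mem_vars`.

References: [Matsumura1987, §27]; [Lang2002, Ch. IV §1]; [AbramovichTemkinWlodarczyk2024, §5.1 (p. 1575), Thm. 5.3.1 (2)–(3) (p. 1578)].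
-/

namespace Literature.AlgebraicGeometry.Resolution.WeightedBlowup.BottomClimb

open Polynomial OrderFiltration LevelProjection ZKernel

variable {k : Type*} [CommRing k] {ι : Type*} {p : ℕ} {u : ℕ → k} {w : ι → ℚ}

/-- `exp_{<p}(T𝔇)(ε_i) ≡ ε_i (mod T)` (`u₀ = 1`, `0 < p`; bookkeeping). [cite: Matsumura1987, §27 (pp. 207–209)] -/
theorem coeff_zero_sigmaExp_X (hu : ∀ n < p, (Nat.factorial n : k) * u n = 1) (hp : 0 < p)
    (D : Derivation k (MvPolynomial ι k) (MvPolynomial ι k)) (i : ι) : (sigmaExp D p u (MvPolynomial.X i)).coeff 0 = MvPolynomial.X i := by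
  have hu0 : u 0 = 1 := by have h := hu 0 hp; rwa [Nat.factorial_zero, Nat.cast_one, one_mul] at h
  rw [coeff_sigmaExp_X, if_pos hp, hu0, one_smul, Function.iterate_zero_apply]

/-- **Higher `T`-coefficients of `exp_{<p}(T𝔇)(ε_i)` involve only variables LIGHTER than `ε_i`** when `𝔇` has degree `−r < 0` and the weights are `≥ 0`
(`u_n 𝔇^n(ε_i)` weighs `w i − n r < w i`; bookkeeping). [cite: AbramovichTemkinWlodarczyk2024, Thm. 5.3.1 (2)–(3) (p. 1578); Matsumura1987, §27] -/
theorem lt_of_mem_vars_coeff_sigmaExp_X (hw : ∀ i, 0 ≤ w i) {D : Derivation k (MvPolynomial ι k) (MvPolynomial ι k)} {r : ℚ}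
    (hDX : ∀ i, MvPolynomial.IsWeightedHomogeneous w (D (MvPolynomial.X i)) (w i - r)) (hr : 0 < r) (i : ι) {n : ℕ} (hn : 1 ≤ n) {j : ι}
    (hj : j ∈ ((sigmaExp D p u (MvPolynomial.X i)).coeff n).vars) : w j < w i := by
  rw [coeff_sigmaExp_X] at hj
  split_ifs at hj with hnp
  · rw [MvPolynomial.smul_eq_C_mul] at hj
    have hh : MvPolynomial.IsWeightedHomogeneous w (MvPolynomial.C (u n) * D^[n] (MvPolynomial.X i)) (0 + (w i - n • r)) :=
      (MvPolynomial.isWeightedHomogeneous_C w (u n)).mul (TailedLightFlow.isWeightedHomogeneous_iterate_X D hDX i n)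
    have hle := le_of_mem_vars hw hh hj
    rw [zero_add, nsmul_eq_mul] at hle
    have h1 : (1 : ℚ) ≤ n := by exact_mod_cast hn
    nlinarith
  · rw [MvPolynomial.vars_0] at hj
    exact absurd hj (Finset.notMem_empty j)

/-- The slot data of THEOREM A⁺'s `k[T]`-substitution (construction, a plain function: heavy slots fixed, light slots `exp_{<p}(T𝔇)(ε_i) + a_i T^q`).
[cite: AbramovichTemkinWlodarczyk2024, §5.1 (p. 1575)] -/
noncomputable def slotData (D : Derivation k (MvPolynomial ι k) (MvPolynomial ι k)) (p : ℕ) (u : ℕ → k) (w : ι → ℚ) (a : ι → MvPolynomial ι k) (q : ℕ)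
    (i : ι) : (MvPolynomial ι k)[X] :=
  if (p : ℚ) + 1 < w i then C (MvPolynomial.X i) else sigmaExp D p u (MvPolynomial.X i) + C (a i) * X ^ q

/-- `slotData` on a heavy slot (bookkeeping). [cite: AbramovichTemkinWlodarczyk2024, §5.1 (p. 1575)] -/
theorem slotData_of_lt (D : Derivation k (MvPolynomial ι k) (MvPolynomial ι k)) (a : ι → MvPolynomial ι k) (q : ℕ) {i : ι} (hi : (p : ℚ) + 1 < w i) :
    slotData D p u w a q i = C (MvPolynomial.X i) := if_pos hi

/-- `slotData` on a light slot (bookkeeping). [cite: AbramovichTemkinWlodarczyk2024, §5.1 (p. 1575)] -/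
theorem slotData_of_le (D : Derivation k (MvPolynomial ι k) (MvPolynomial ι k)) (a : ι → MvPolynomial ι k) (q : ℕ) {i : ι} (hi : w i ≤ (p : ℚ) + 1) :
    slotData D p u w a q i = sigmaExp D p u (MvPolynomial.X i) + C (a i) * X ^ q := if_neg (not_lt.mpr hi)

/-- **`P_i ≡ ε_i (mod T)`** for the slot data (`q ≥ 1`; hypothesis `h0` of `killRank_lt_of_bottom`; bookkeeping). [cite: Lang2002, Ch. IV §1; Matsumura1987, §27] -/
theorem coeff_zero_slotData (hu : ∀ n < p, (Nat.factorial n : k) * u n = 1) (hp : 0 < p) (D : Derivation k (MvPolynomial ι k) (MvPolynomial ι k))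
    (a : ι → MvPolynomial ι k) {q : ℕ} (hq : 1 ≤ q) (i : ι) : (slotData D p u w a q i).coeff 0 = MvPolynomial.X i := by
  unfold slotData
  split_ifs
  · rw [coeff_C_zero]
  · rw [coeff_add, coeff_zero_sigmaExp_X hu hp, Polynomial.coeff_C_mul_X_pow, if_neg (by omega), add_zero]

/-- **The higher `T`-coefficients of the slot data involve only lighter variables** (hypothesis `htri` of `killRank_lt_of_bottom`): `𝔇` of degree `−r < 0`, `a_i` of weight
`w i − (p+1)`, weights `≥ 0` (bookkeeping).  Instrument for engine 1's `W(f)` toy model, NOT a resolution theorem.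
[cite: AbramovichTemkinWlodarczyk2024, Thm. 5.3.1 (2)–(3) (p. 1578); Lang2002, Ch. IV §1] -/
theorem lt_of_mem_vars_coeff_slotData (hw : ∀ i, 0 ≤ w i) {D : Derivation k (MvPolynomial ι k) (MvPolynomial ι k)} {r : ℚ}
    (hDX : ∀ i, MvPolynomial.IsWeightedHomogeneous w (D (MvPolynomial.X i)) (w i - r)) (hr : 0 < r) {a : ι → MvPolynomial ι k}
    (ha : ∀ i, MvPolynomial.IsWeightedHomogeneous w (a i) (w i - ((p : ℚ) + 1))) (q : ℕ) (i : ι) {n : ℕ} (hn : 1 ≤ n) {j : ι}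
    (hj : j ∈ ((slotData D p u w a q i).coeff n).vars) : w j < w i := by
  classical
  unfold slotData at hj
  split_ifs at hj
  · rw [coeff_C, if_neg (by omega), MvPolynomial.vars_0] at hj
    exact absurd hj (Finset.notMem_empty j)
  · rw [coeff_add, Polynomial.coeff_C_mul_X_pow] at hj
    rcases Finset.mem_union.mp (MvPolynomial.vars_add_subset _ _ hj) with h | h
    · exact lt_of_mem_vars_coeff_sigmaExp_X hw hDX hr i hn h
    · split_ifs at h
      · have hle := le_of_mem_vars hw (ha i) h
        have hp0 : (0 : ℚ) < (p : ℚ) + 1 := by positivity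
        linarith
      · rw [MvPolynomial.vars_0] at h
        exact absurd h (Finset.notMem_empty j)

end Literature.AlgebraicGeometry.Resolution.WeightedBlowup.BottomClimb
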